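import Mathlib
import HarnessLib
import Summits.ValiantsHypothesis.ValiantsHypothesis.Theorems.KPlusLogSqLawWeakLiftingTowerGraftWronskianKFourShape
import Summits.ValiantsHypothesis.ValiantsHypothesis.Theorems.KPlusLogSqLawWeakLiftingTowerGraftWronskianKFourReflect

/-!
# Tower graft line — CONJECTURE W AT `K = 4` FOLLOWS FROM THE ZONE LAW (kernel reduction to the located target)

Helper file for LINE (B) `Cruxes/WeakLifting/Lines/tower_graft.lean` (crux `WeakLifting` = stmt-ValiantsHypothesis-19561).  NO stub is
claimed.  Hands g10–g11 reduced Conjecture W at `K = 4` («`Z₊(W(u,v)) ≤ 4` for two real `4`-nomials on a common support») to the fully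
alternating Plücker cell (`…KFourReflect.card_posRoots_wronskian_four_le_four_of_cellLaw`) and showed that five zeros force every positive
zero to lie below all three poles `ρ₁, ρ₂, ρ₃` of `U₁, U₂, U₃` or above all three (`…KFourShape.five_zeros_shape`).  The memo
`evidence-g11-conjectureW-K4-levels.md` (item evidence #41, §3b) locates numerically the ZONE LAW «at most two zeros below `min ρ`, at most two
above `max ρ`» on the cell.  This file makes the implication a theorem BY NAME:

* ★★ `card_posRoots_wronskian_four_le_four_of_zoneLaw` — ZONE LAW (on the orientation `d₀ + d₃ < d₁ + d₂`, fully alternating cell, for any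
  positive roots `ρ_k` of `U_k`: `#{x ∈ Z₊(W) : x < ρ₁, ρ₂, ρ₃} ≤ 2` and `#{x ∈ Z₊(W) : x > ρ₁, ρ₂, ρ₃} ≤ 2`) ⇒ `Z₊(W(u,v)) ≤ 4` for ALL pairs
  of real `4`-nomials on a common strictly increasing support.

HONEST FRAMING: the zone law is OPEN (located only: pure-python searches, memo §3b); nothing on S4/S4f/S5/S5ᴸ, TowerB, `WeakLifting`,
Conjecture B, `MatrixDescartes` (18050), `VP ≠ VNP`.  Def-free.  Seat: prover leafhand-val-kpluslogsqlaw-1 g11, `--supports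
stmt-ValiantsHypothesis-19561 --as helper`.  [this work]
-/

-- `Summit.ValiantsHypothesis.ValiantsHypothesis.…` repeats a component by the D-0017 layout
-- (single-conjunct summit), which the `dupNamespace` linter flags; the name is mandated.
set_option linter.dupNamespace false
set_option autoImplicit false

namespace Summit.ValiantsHypothesis.ValiantsHypothesis.Theorems.KPlusLogSqLaw.TowerGraft

open Polynomial Finset
open scoped BigOperators Polynomial

namespace WronskianDevelopable

/-- ★★ **CONJECTURE W AT `K = 4` FOLLOWS FROM THE ZONE LAW.** [this work] -/
theorem card_posRoots_wronskian_four_le_four_of_zoneLaw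
    (ZL : ∀ (u v : Fin 4 → ℝ) (d : Fin 4 → ℕ), StrictMono d → d 0 + d 3 < d 1 + d 2 →
      (u 0 * v 1 - u 1 * v 0) * (u 0 * v 2 - u 2 * v 0) < 0 → (u 0 * v 2 - u 2 * v 0) * (u 0 * v 3 - u 3 * v 0) < 0 →
      (u 0 * v 3 - u 3 * v 0) * (u 1 * v 2 - u 2 * v 1) < 0 → (u 1 * v 2 - u 2 * v 1) * (u 1 * v 3 - u 3 * v 1) < 0 →
      (u 1 * v 3 - u 3 * v 1) * (u 2 * v 3 - u 3 * v 2) < 0 →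
      ∀ ρ₁ ρ₂ ρ₃ : ℝ, 0 < ρ₁ → 0 < ρ₂ → 0 < ρ₃ →
        (∑ l, C (u l * v 1 - u 1 * v l) * (X : ℝ[X]) ^ d l).eval ρ₁ = 0 →
        (∑ l, C (u l * v 2 - u 2 * v l) * (X : ℝ[X]) ^ d l).eval ρ₂ = 0 →
        (∑ l, C (u l * v 3 - u 3 * v l) * (X : ℝ[X]) ^ d l).eval ρ₃ = 0 →
        ((((wronskian (∑ l, C (u l) * (X : ℝ[X]) ^ d l) (∑ l, C (v l) * (X : ℝ[X]) ^ d l)).roots.toFinset.filter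
            (fun x => 0 < x)).filter (fun x => x < ρ₁ ∧ x < ρ₂ ∧ x < ρ₃)).card ≤ 2 ∧
         (((wronskian (∑ l, C (u l) * (X : ℝ[X]) ^ d l) (∑ l, C (v l) * (X : ℝ[X]) ^ d l)).roots.toFinset.filter
            (fun x => 0 < x)).filter (fun x => ρ₁ < x ∧ ρ₂ < x ∧ ρ₃ < x)).card ≤ 2))
    (u v : Fin 4 → ℝ) (d : Fin 4 → ℕ) (hd : StrictMono d) :
    ((wronskian (∑ l, C (u l) * (X : ℝ[X]) ^ d l) (∑ l, C (v l) * (X : ℝ[X]) ^ d l)).roots.toFinset.filter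
      (fun x => 0 < x)).card ≤ 4 := by
  classical
  refine card_posRoots_wronskian_four_le_four_of_cellLaw ?_ u v d hd
  intro u v d hd hA c1 c2 c3 c4 c5
  by_contra hgt
  have h5 : 5 ≤ ((wronskian (∑ l, C (u l) * (X : ℝ[X]) ^ d l) (∑ l, C (v l) * (X : ℝ[X]) ^ d l)).roots.toFinset.filter
      (fun x => 0 < x)).card := by omega
  obtain ⟨ρ₁, ρ₂, ρ₃, hρ₁, hρ₂, hρ₃, hr1, hr2, hr3, hall⟩ := five_zeros_shape u v d hd hA h5
  obtain ⟨hlo, hhi⟩ := ZL u v d hd hA c1 c2 c3 c4 c5 ρ₁ ρ₂ ρ₃ hρ₁ hρ₂ hρ₃ hr1 hr2 hr3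
  set S := (wronskian (∑ l, C (u l) * (X : ℝ[X]) ^ d l) (∑ l, C (v l) * (X : ℝ[X]) ^ d l)).roots.toFinset.filter
      (fun x => 0 < x) with hS
  -- every zero is in one of the two zones
  have hcover : S ⊆ S.filter (fun x => x < ρ₁ ∧ x < ρ₂ ∧ x < ρ₃) ∪ S.filter (fun x => ρ₁ < x ∧ ρ₂ < x ∧ ρ₃ < x) := by
    intro x hx
    rcases hall x hx with h | h
    · exact Finset.mem_union.mpr (Or.inl (Finset.mem_filter.mpr ⟨hx, h⟩))
    · exact Finset.mem_union.mpr (Or.inr (Finset.mem_filter.mpr ⟨hx, h⟩))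
  have := (Finset.card_le_card hcover).trans (Finset.card_union_le _ _)
  omega

end WronskianDevelopable

end Summit.ValiantsHypothesis.ValiantsHypothesis.Theorems.KPlusLogSqLaw.TowerGraft
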